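import Literature.NumberTheory.EllipticCurves.UnramifiedLayerRootsProofs
import Mathlib.FieldTheory.Finite.Basic
import Mathlib.Algebra.CharP.Frobenius
import Mathlib.Algebra.Polynomial.BigOperators
import HarnessLib

/-!
# Residues of the unramified layers: Teichmüller lifts of `𝔽_{qⁿ}` and additive Hilbert 90

`Proofs` file (theorems only, no definitions, no named facts) in topic
`NumberTheory/EllipticCurves`; a bottom-up step of the discharge of the named fact
`Literature.NumberTheory.EllipticCurves.Milne2006_unramifiedClass_eq_zero` (`PeriodIndexSupport`;
Milne, *Arithmetic Duality Theorems*, Prop. I.3.8), sequel of `UnramifiedLayerRootsProofs`.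

For the layer `K_v(ζ) ⊆ K̄_v` (`ζ` a primitive `(qⁿ - 1)`-th root of unity, `q = #k_v`) and the
residue map `r : 𝒪_w → k̄_v` of the spectral valuation `w` (`exists_residueMap` of
`HasseWeilGoodReductionFrobeniusProofs`: kernel `{w < 1}`, carrying the arithmetic Frobenius `F`
to `x ↦ x^q`), this file proves:

* §1 (pure algebra, any field `M`) for a primitive `m`-th root of unity `ζ̄`: the `m + 1`
  elements `{0} ∪ {ζ̄ⁱ}` are exactly the solutions of `x^{m+1} = x`
  (`mem_insert_zero_image_pow_of_pow_eq`, counting roots of `X^{m+1} - X`); and **additive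
  Hilbert 90 for `𝔽_{qⁿ}/𝔽_q` in explicit form** (`exists_frobenius_sub_eq_of_trace_eq_zero`): in
  a field of exponential characteristic `p`, `q = p^f`, containing a primitive `(qⁿ - 1)`-th root
  of unity, every `a` with `a^{qⁿ} = a` and `Σ_{j<n} a^{qʲ} = 0` is `b^q - b` with `b^{qⁿ} = b` —
  by the classical formula `b = -(Σ_{j<n} (Σ_{i≤j} a^{qⁱ}) θ^{qʲ}) / Tr(θ)` for any `θ ∈ 𝔽_{qⁿ}`
  with `Tr(θ) = Σ_{j<n} θ^{qʲ} ≠ 0` (which exists: the trace polynomial has degree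
  `q^{n-1} < qⁿ = #𝔽_{qⁿ}`); Serre, *Local Fields*, X §1 (`H¹(G, L⁺) = 0`), here for the cyclic
  group generated by the `q`-Frobenius;
* §2 in `K̄_v`: `r(Fʲ z) = r(z)^{qʲ}`; the residue `ζ̄ = r(ζ)` is a primitive `(qⁿ - 1)`-th root
  of unity (reduction is injective on `μ_{qⁿ-1}`, `UnramifiedLayerRootsProofs`); **Teichmüller
  surjectivity** (`exists_residue_eq_of_pow_eq`: every `x̄ ∈ k̄_v` with `x̄^{qⁿ} = x̄` is the
  residue of `0` or a power of `ζ`, an integral element of `K_v(ζ)`); residues of integral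
  elements of `K_v(ζ)` satisfy `x̄^{qⁿ} = x̄` (`Fⁿ = 1` on `K_v(ζ)`); and the **residue equation
  of the layer** (`exists_frobenius_smul_sub_sub_lt_one`): for `a ∈ 𝒪_{K_v(ζ)}` with
  `|Σ_{j<n} Fʲ a|_v < 1` there is `b ∈ 𝒪_{K_v(ζ)}` with `|F b - b - a|_v < 1` — hypothesis `hres`
  of the abstract successive approximation `FormalGroupChart.exists_map_sub_eq_of_sum_eq_zero`
  (`UnramifiedFormalGroupH1Proofs`), i.e. the vanishing of `H¹` on the graded pieces
  `𝔪ʳ/𝔪ʳ⁺¹ ≅ 𝔽_{qⁿ}` of the filtration of `E₁(K_v(ζ))`.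

## References

* [SerreLocalFields1979] J.-P. Serre, *Local Fields*, GTM 67 (1979), II §4 Prop. 8
  (multiplicative representatives), IV §4 Prop. 16, X §1 Prop. 1 (additive Hilbert 90).
* [MilneADT2006] J. S. Milne, *Arithmetic Duality Theorems*, 2nd ed. (2006), Prop. I.3.8.

## Design

No definitions; `noncomputable section`; `open scoped Classical NNReal Pointwise`; one universe
`u`.  The residue map and the Frobenius are hypotheses (`hr`, `hrF`) exactly in the form produced
by `exists_residueMap`; `q` is always `Nat.card (IsLocalRing.ResidueField 𝓞_v)`.
-/

noncomputable section

open scoped Classical NNReal Pointwise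
open NumberField IsDedekindDomain Polynomial

universe u

/-! ## §1 Finite-field algebra: Teichmüller sets and additive Hilbert 90 -/

namespace Literature.NumberTheory.EllipticCurves

section FiniteFieldLayer

variable {M : Type*} [Field M]

/-- For a primitive `m`-th root of unity `ζ`, the finset `{0} ∪ {ζⁱ : i < m}` has `m + 1`
elements. [folklore] -/
theorem card_insert_zero_image_pow {ζ : M} {m : ℕ} (hζ : IsPrimitiveRoot ζ m) (hm : m ≠ 0) :
    (insert (0 : M) ((Finset.range m).image (fun i : ℕ ↦ ζ ^ i))).card = m + 1 := by
  rw [Finset.card_insert_of_notMem, Finset.card_image_of_injOn, Finset.card_range]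
  · intro i hi j hj h
    exact hζ.pow_inj (Finset.mem_coe.mp hi |> Finset.mem_range.mp)
      (Finset.mem_coe.mp hj |> Finset.mem_range.mp) h
  · simp only [Finset.mem_image, Finset.mem_range, not_exists, not_and]
    intro i _ h
    exact pow_ne_zero i (hζ.ne_zero hm) h

/-- Every element of `{0} ∪ {ζⁱ}` (`ζ^m = 1`) satisfies `x^{m+1} = x`. [folklore] -/
theorem pow_succ_eq_self_of_mem_insert_zero_image_pow {ζ : M} {m : ℕ} (hζm : ζ ^ m = 1) {x : M}
    (hx : x ∈ insert (0 : M) ((Finset.range m).image (fun i : ℕ ↦ ζ ^ i))) : x ^ (m + 1) = x := by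
  rcases Finset.mem_insert.mp hx with rfl | hx
  · exact zero_pow (Nat.succ_ne_zero m)
  · obtain ⟨i, -, rfl⟩ := Finset.mem_image.mp hx
    rw [show (ζ ^ i) ^ (m + 1) = ζ ^ i * (ζ ^ m) ^ i by ring, hζm, one_pow, mul_one]

/-- **`{0} ∪ {ζⁱ}` is the full solution set of `x^{m+1} = x`** for a primitive `m`-th root of
unity `ζ` (the polynomial `X^{m+1} - X` has at most `m + 1` roots).  With `m + 1 = qⁿ` this is
"`𝔽_{qⁿ} = {0} ∪ μ_{qⁿ-1}`". [folklore] -/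
theorem mem_insert_zero_image_pow_of_pow_eq {ζ : M} {m : ℕ} (hζ : IsPrimitiveRoot ζ m) (hm : m ≠ 0)
    {x : M} (hx : x ^ (m + 1) = x) :
    x ∈ insert (0 : M) ((Finset.range m).image (fun i : ℕ ↦ ζ ^ i)) := by
  have hN : 1 < m + 1 := by omega
  have hP0 : (X ^ (m + 1) - X : M[X]) ≠ 0 := FiniteField.X_pow_card_sub_X_ne_zero M hN
  have hdeg : (X ^ (m + 1) - X : M[X]).natDegree = m + 1 :=
    FiniteField.X_pow_card_sub_X_natDegree_eq M hN
  have hmemR : ∀ y : M, y ∈ (X ^ (m + 1) - X : M[X]).roots.toFinset ↔ y ^ (m + 1) = y := by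
    intro y
    rw [Multiset.mem_toFinset, mem_roots hP0, IsRoot.def, eval_sub, eval_pow, eval_X, sub_eq_zero]
  have hsub : insert (0 : M) ((Finset.range m).image (fun i : ℕ ↦ ζ ^ i)) ⊆
      (X ^ (m + 1) - X : M[X]).roots.toFinset := fun y hy ↦
    (hmemR y).mpr (pow_succ_eq_self_of_mem_insert_zero_image_pow hζ.pow_eq_one hy)
  have hcard : (X ^ (m + 1) - X : M[X]).roots.toFinset.card ≤
      (insert (0 : M) ((Finset.range m).image (fun i : ℕ ↦ ζ ^ i))).card := by
    rw [card_insert_zero_image_pow hζ hm]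
    calc (X ^ (m + 1) - X : M[X]).roots.toFinset.card ≤ Multiset.card (X ^ (m + 1) - X : M[X]).roots :=
          Multiset.toFinset_card_le _
      _ ≤ (X ^ (m + 1) - X : M[X]).natDegree := card_roots' _
      _ = m + 1 := hdeg
  rw [Finset.eq_of_subset_of_card_le hsub hcard]
  exact (hmemR x).mpr hx

/-- Shift of the `q`-power sum: `Σ_{j<n} y^{q^{j+1}} = Σ_{j<n} y^{qʲ}` when `y^{qⁿ} = y`.
[folklore] -/
theorem sum_pow_pow_succ_eq {y : M} {q n : ℕ} (hy : y ^ q ^ n = y) :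
    ∑ j ∈ Finset.range n, y ^ q ^ (j + 1) = ∑ j ∈ Finset.range n, y ^ q ^ j := by
  have e1 := Finset.sum_range_succ' (fun j ↦ y ^ q ^ j) n
  have e2 := Finset.sum_range_succ (fun j ↦ y ^ q ^ j) n
  rw [pow_zero, pow_one] at e1
  rw [hy] at e2
  have := e1.symm.trans e2
  exact add_right_cancel this

/-- **Additive Hilbert 90 for `𝔽_{qⁿ}/𝔽_q`, explicit form.**  Let `M` be a field of exponential
characteristic `p`, `q = p^f > 1`, `n ≥ 1`, containing a primitive `(qⁿ - 1)`-th root of unity (so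
that `{x : x^{qⁿ} = x} ⊆ M` is a copy of `𝔽_{qⁿ}`).  If `a^{qⁿ} = a` and `Σ_{j<n} a^{qʲ} = 0`
(trace zero) then `a = b^q - b` for some `b` with `b^{qⁿ} = b`: with `θ` of non-zero trace
`t = Σ_{j<n} θ^{qʲ}` and `A_j = Σ_{i≤j} a^{qⁱ}`, the element `b = -(Σ_{j<n} A_j θ^{qʲ})/t` works
(`σ A_j = A_{j+1} - a`, `A_n = a`, `σ t = t` for the `q`-Frobenius `σ`).  Serre, *Local Fields*,
X §1 Prop. 1 (`H¹(G, L) = 0` for the additive group); here `G = Gal(𝔽_{qⁿ}/𝔽_q) = ⟨σ⟩`.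
[cite: SerreLocalFields1979, Ch. X §1 Prop. 1] -/
theorem exists_frobenius_sub_eq_of_trace_eq_zero (p : ℕ) [ExpChar M p] (f : ℕ) {n : ℕ}
    (hq : 1 < p ^ f) (hn : n ≠ 0) {ζ : M} (hζ : IsPrimitiveRoot ζ ((p ^ f) ^ n - 1))
    {a : M} (ha : a ^ (p ^ f) ^ n = a) (htr : ∑ j ∈ Finset.range n, a ^ (p ^ f) ^ j = 0) :
    ∃ b : M, b ^ (p ^ f) ^ n = b ∧ b ^ p ^ f - b = a := by
  -- notation: `q = p^f`, Frobenius ring homomorphisms `σ x = x^q`, `ψ x = x^{qⁿ}`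
  have hσ : ∀ x : M, iterateFrobenius M p f x = x ^ p ^ f := fun x ↦ iterateFrobenius_def ..
  have hψ : ∀ x : M, iterateFrobenius M p (f * n) x = x ^ (p ^ f) ^ n := fun x ↦ by
    rw [iterateFrobenius_def, pow_mul]
  have hσpow : ∀ (x : M) (i : ℕ), iterateFrobenius M p f (x ^ (p ^ f) ^ i) = x ^ (p ^ f) ^ (i + 1) :=
    fun x i ↦ by rw [hσ, ← pow_mul, ← pow_succ]
  -- the Teichmüller set `T = {0} ∪ {ζⁱ}` has `qⁿ` elements fixed by `ψ`
  have hm0 : (p ^ f) ^ n - 1 ≠ 0 := (Nat.sub_pos_of_lt (Nat.one_lt_pow hn hq)).ne'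
  have hm1 : (p ^ f) ^ n - 1 + 1 = (p ^ f) ^ n := Nat.sub_add_cancel (Nat.one_le_pow n _ (by omega))
  have hTcard := card_insert_zero_image_pow hζ hm0
  rw [hm1] at hTcard
  have hTfix : ∀ x ∈ insert (0 : M) ((Finset.range ((p ^ f) ^ n - 1)).image (fun i : ℕ ↦ ζ ^ i)),
      x ^ (p ^ f) ^ n = x := fun x hx ↦ by
    have := pow_succ_eq_self_of_mem_insert_zero_image_pow hζ.pow_eq_one hx
    rwa [hm1] at this
  -- the trace polynomial `Σ_{j<n} X^{qʲ}` is non-zero of degree `≤ q^{n-1}`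
  have hTr_ne : (∑ j ∈ Finset.range n, X ^ (p ^ f) ^ j : M[X]) ≠ 0 := by
    intro h
    have hc := congrArg (fun P : M[X] ↦ P.coeff ((p ^ f) ^ (n - 1))) h
    simp only [finsetSum_coeff, coeff_X_pow, coeff_zero] at hc
    rw [Finset.sum_eq_single (n - 1)] at hc
    · simp at hc
    · intro j hj hjn
      rw [if_neg]
      intro he
      exact hjn (Nat.pow_right_injective hq he).symm
    · intro h; exact absurd (Finset.mem_range.mpr (by omega)) h
  have hTr_deg : (∑ j ∈ Finset.range n, X ^ (p ^ f) ^ j : M[X]).natDegree ≤ (p ^ f) ^ (n - 1) := by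
    refine natDegree_sum_le_of_forall_le (s := Finset.range n)
      (fun j ↦ (X ^ (p ^ f) ^ j : M[X])) (fun j hj ↦ ?_)
    rw [natDegree_X_pow]
    exact Nat.pow_le_pow_right (by omega) (by have := Finset.mem_range.mp hj; omega)
  have hTr_eval : ∀ x : M, (∑ j ∈ Finset.range n, X ^ (p ^ f) ^ j : M[X]).eval x =
      ∑ j ∈ Finset.range n, x ^ (p ^ f) ^ j := fun x ↦ by
    rw [eval_finsetSum]; simp only [eval_pow, eval_X]
  -- an element `θ ∈ T` of non-zero trace
  obtain ⟨θ, hθT, hθ⟩ : ∃ θ ∈ insert (0 : M) ((Finset.range ((p ^ f) ^ n - 1)).image (fun i : ℕ ↦ ζ ^ i)),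
      ∑ j ∈ Finset.range n, θ ^ (p ^ f) ^ j ≠ 0 := by
    by_contra! h
    have hsub : insert (0 : M) ((Finset.range ((p ^ f) ^ n - 1)).image (fun i : ℕ ↦ ζ ^ i)) ⊆
        (∑ j ∈ Finset.range n, X ^ (p ^ f) ^ j : M[X]).roots.toFinset := fun x hx ↦ by
      rw [Multiset.mem_toFinset, mem_roots hTr_ne, IsRoot.def, hTr_eval]
      exact h x hx
    have h1 := (Finset.card_le_card hsub).trans ((Multiset.toFinset_card_le _).trans
      ((card_roots' _).trans hTr_deg))
    rw [hTcard] at h1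
    exact absurd h1 (not_le.mpr (Nat.pow_lt_pow_right hq (by omega)))
  have hθfix : θ ^ (p ^ f) ^ n = θ := hTfix θ hθT
  -- `σ t = t` for the trace `t` of `θ`
  have hσt : iterateFrobenius M p f (∑ j ∈ Finset.range n, θ ^ (p ^ f) ^ j) =
      ∑ j ∈ Finset.range n, θ ^ (p ^ f) ^ j := by
    rw [map_sum]; simp_rw [hσpow]; exact sum_pow_pow_succ_eq hθfix
  -- the partial traces `A_j`
  have hσA : ∀ j : ℕ, iterateFrobenius M p f (∑ i ∈ Finset.range (j + 1), a ^ (p ^ f) ^ i) =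
      (∑ i ∈ Finset.range (j + 2), a ^ (p ^ f) ^ i) - a := by
    intro j
    rw [map_sum]; simp_rw [hσpow]
    rw [Finset.sum_range_succ' (fun i ↦ a ^ (p ^ f) ^ i) (j + 1), pow_zero, pow_one, add_sub_cancel_right]
  have hAn : ∑ i ∈ Finset.range (n + 1), a ^ (p ^ f) ^ i = a := by
    rw [Finset.sum_range_succ, htr, zero_add, ha]
  -- `σ b' = b' - a t` for `b' = Σ_{j<n} A_j θ^{qʲ}`
  have hσb' : iterateFrobenius M p f
      (∑ j ∈ Finset.range n, (∑ i ∈ Finset.range (j + 1), a ^ (p ^ f) ^ i) * θ ^ (p ^ f) ^ j) =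
      (∑ j ∈ Finset.range n, (∑ i ∈ Finset.range (j + 1), a ^ (p ^ f) ^ i) * θ ^ (p ^ f) ^ j) -
        a * ∑ j ∈ Finset.range n, θ ^ (p ^ f) ^ j := by
    rw [map_sum]
    simp_rw [map_mul, hσA, hσpow, sub_mul]
    rw [Finset.sum_sub_distrib, ← Finset.mul_sum, sum_pow_pow_succ_eq hθfix]
    congr 1
    -- `Σ_{j<n} A_{j+1} θ^{q^{j+1}} = Σ_{j<n} A_j θ^{qʲ}`: shift and use `A_n θ^{qⁿ} = a θ = A_0 θ`
    have e1 := Finset.sum_range_succ'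
      (fun j ↦ (∑ i ∈ Finset.range (j + 1), a ^ (p ^ f) ^ i) * θ ^ (p ^ f) ^ j) n
    have e2 := Finset.sum_range_succ
      (fun j ↦ (∑ i ∈ Finset.range (j + 1), a ^ (p ^ f) ^ i) * θ ^ (p ^ f) ^ j) n
    simp only [zero_add, Finset.range_one, Finset.sum_singleton, pow_zero, pow_one] at e1
    rw [hAn, hθfix] at e2
    have := e1.symm.trans e2
    exact add_right_cancel this
  -- the solution
  set t := ∑ j ∈ Finset.range n, θ ^ (p ^ f) ^ j with ht
  set b' := ∑ j ∈ Finset.range n, (∑ i ∈ Finset.range (j + 1), a ^ (p ^ f) ^ i) * θ ^ (p ^ f) ^ j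
    with hb'
  refine ⟨-(b' * t⁻¹), ?_, ?_⟩
  · -- fixed by `ψ`
    have hψa : iterateFrobenius M p (f * n) a = a := by rw [hψ]; exact ha
    have hψθ : iterateFrobenius M p (f * n) θ = θ := by rw [hψ]; exact hθfix
    rw [← hψ]
    simp only [hb', ht, map_neg, map_mul, map_inv₀, map_sum, map_pow, hψa, hψθ]
  · rw [← hσ, map_neg, map_mul, map_inv₀, hσb', hσt]
    field_simp
    ring

end FiniteFieldLayer

end Literature.NumberTheory.EllipticCurves

/-! ## §2 Residues in `K̄_v`: Frobenius, Teichmüller lifts, the residue equation of the layer -/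

namespace IsDedekindDomain.HeightOneSpectrum

open Literature.NumberTheory.EllipticCurves Literature.NumberTheory.GaloisRepresentations Field

variable {K : Type u} [Field K] [NumberField K] {v : HeightOneSpectrum (𝓞 K)}
  {w : Valuation (AlgebraicClosure (v.adicCompletion K)) ℝ≥0}
  (hw : ∀ x, (w x : ℝ) = spectralNorm (v.adicCompletion K) (AlgebraicClosure (v.adicCompletion K)) x)
  {𝔐 : Ideal v.localAbsIntegers} (h𝔐 : 𝔐 ∈ v.localPrimesAbove)
  {F : absoluteGaloisGroup (v.adicCompletion K)}
  (hF : IsArithFrobAt (v.adicCompletionIntegers K) F 𝔐)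
  {r : w.integer →+* AlgebraicClosure (IsLocalRing.ResidueField (v.adicCompletionIntegers K))}
  (hr : ∀ a : w.integer, r a = 0 ↔ w (a : AlgebraicClosure (v.adicCompletion K)) < 1)
  (hrF : ∀ (z : w.integer) (h : w (F • (z : AlgebraicClosure (v.adicCompletion K))) ≤ 1),
    r ⟨F • (z : AlgebraicClosure (v.adicCompletion K)), h⟩ =
      r z ^ Nat.card (IsLocalRing.ResidueField (v.adicCompletionIntegers K)))

include hr in
/-- Two integral elements have the same residue iff they are congruent: `r x = r y ↔ |x - y| < 1`.
[folklore] -/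
theorem residue_eq_residue_iff (x y : w.integer) :
    r x = r y ↔ w ((x : AlgebraicClosure (v.adicCompletion K)) - y) < 1 := by
  rw [← sub_eq_zero, ← map_sub, hr]
  rfl

include hw in
/-- `|σ z|_v ≤ 1` for integral `z` (Galois isometry). [folklore] -/
theorem spectralValuation_smul_le_one (σ : absoluteGaloisGroup (v.adicCompletion K)) (z : w.integer) :
    w (σ • (z : AlgebraicClosure (v.adicCompletion K))) ≤ 1 := by
  rw [spectralValuation_smul hw]; exact z.2

include hw hrF in
/-- **Residues of Frobenius powers**: `r(Fʲ z) = r(z)^{qʲ}`. [folklore] -/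
theorem residue_frobenius_pow_smul (j : ℕ) (z : w.integer)
    (h : w (F ^ j • (z : AlgebraicClosure (v.adicCompletion K))) ≤ 1) :
    r ⟨F ^ j • (z : AlgebraicClosure (v.adicCompletion K)), h⟩ =
      r z ^ Nat.card (IsLocalRing.ResidueField (v.adicCompletionIntegers K)) ^ j := by
  induction j with
  | zero =>
    have e : (⟨F ^ 0 • (z : AlgebraicClosure (v.adicCompletion K)), h⟩ : w.integer) = z :=
      Subtype.ext (by change F ^ 0 • (z : AlgebraicClosure (v.adicCompletion K)) = z; rw [pow_zero, one_smul])
    rw [e, pow_zero, pow_one]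
  | succ j ih =>
    have hj : w (F ^ j • (z : AlgebraicClosure (v.adicCompletion K))) ≤ 1 :=
      spectralValuation_smul_le_one hw _ z
    have e : F ^ (j + 1) • (z : AlgebraicClosure (v.adicCompletion K)) =
        F • ((⟨F ^ j • (z : AlgebraicClosure (v.adicCompletion K)), hj⟩ : w.integer) :
          AlgebraicClosure (v.adicCompletion K)) := by
      rw [pow_succ', mul_smul]
    have h' : w (F • ((⟨F ^ j • (z : AlgebraicClosure (v.adicCompletion K)), hj⟩ : w.integer) :
        AlgebraicClosure (v.adicCompletion K))) ≤ 1 := by rw [← e]; exact h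
    have : r ⟨F ^ (j + 1) • (z : AlgebraicClosure (v.adicCompletion K)), h⟩ =
        r ⟨F • ((⟨F ^ j • (z : AlgebraicClosure (v.adicCompletion K)), hj⟩ : w.integer) :
          AlgebraicClosure (v.adicCompletion K)), h'⟩ := by
      congr 1; exact Subtype.ext e
    rw [this, hrF, ih hj, ← pow_mul, ← pow_succ]

section Roots

variable {n : ℕ} (hn : n ≠ 0) {ζ : AlgebraicClosure (v.adicCompletion K)}
  (hζ : IsPrimitiveRoot ζ (Nat.card (IsLocalRing.ResidueField (v.adicCompletionIntegers K)) ^ n - 1))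

include hn hζ in
/-- `|ζ|_v ≤ 1` for a `(qⁿ - 1)`-th root of unity. [folklore] -/
theorem spectralValuation_le_one_of_isPrimitiveRoot : w ζ ≤ 1 :=
  (val_eq_one_of_pow_eq_one w (residueCard_pow_sub_one_ne_zero (v := v) hn) hζ.pow_eq_one).le

include hw hr hn hζ in
/-- **The residue of a primitive `(qⁿ - 1)`-th root of unity is a primitive `(qⁿ - 1)`-th root of
unity** (reduction is injective on `μ_{qⁿ-1}`).  Serre, *Local Fields*, IV §4 Prop. 16.
[cite: SerreLocalFields1979, Ch. IV §4 Prop. 16] -/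
theorem isPrimitiveRoot_residue (h1 : w ζ ≤ 1) :
    IsPrimitiveRoot (r ⟨ζ, h1⟩)
      (Nat.card (IsLocalRing.ResidueField (v.adicCompletionIntegers K)) ^ n - 1) := by
  set m := Nat.card (IsLocalRing.ResidueField (v.adicCompletionIntegers K)) ^ n - 1 with hm
  have hm0 : m ≠ 0 := residueCard_pow_sub_one_ne_zero (v := v) hn
  have hmw : w (m : AlgebraicClosure (v.adicCompletion K)) = 1 :=
    spectralValuation_natCast_residueCard_pow_sub_one hw hn
  rw [IsPrimitiveRoot.iff_def]
  refine ⟨?_, fun l hl ↦ ?_⟩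
  · rw [← map_pow, ← map_one r]
    congr 1
    exact Subtype.ext (by rw [SubmonoidClass.coe_pow]; exact hζ.pow_eq_one)
  · -- `r (ζ^l) = 1 ⇒ |ζ^l - 1| < 1 ⇒ ζ^l = 1`
    have h2 : w (((⟨ζ, h1⟩ ^ l : w.integer) : AlgebraicClosure (v.adicCompletion K)) - (1 : w.integer)) < 1 := by
      rw [← residue_eq_residue_iff hr, map_pow, map_one]; exact hl
    rw [SubmonoidClass.coe_pow, OneMemClass.coe_one] at h2
    have h3 : (ζ ^ l) ^ m = 1 := by rw [← pow_mul, mul_comm, pow_mul, hζ.pow_eq_one, one_pow]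
    have h4 := eq_one_of_pow_eq_one_of_val_sub_lt_one w hm0 hmw h3 h2
    exact (hζ.pow_eq_one_iff_dvd l).mp h4

include hw hr hn hζ in
/-- **Teichmüller surjectivity onto `𝔽_{qⁿ}`**: every `x̄ ∈ k̄_v` with `x̄^{qⁿ} = x̄` is the
residue of `0` or of a power of `ζ`, an integral element of the layer `K_v(ζ)`
(`𝔽_{qⁿ} = {0} ∪ μ_{qⁿ-1}` and `r` is a bijection `μ_{qⁿ-1}(K̄_v) → μ_{qⁿ-1}(k̄_v)`).  Serre,
*Local Fields*, II §4 Prop. 8 (multiplicative representatives).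
[cite: SerreLocalFields1979, Ch. II §4 Prop. 8] -/
theorem exists_residue_eq_of_pow_eq {x : AlgebraicClosure (IsLocalRing.ResidueField (v.adicCompletionIntegers K))}
    (hx : x ^ Nat.card (IsLocalRing.ResidueField (v.adicCompletionIntegers K)) ^ n = x) :
    ∃ t : AlgebraicClosure (v.adicCompletion K),
      t ∈ IntermediateField.adjoin (v.adicCompletion K) {ζ} ∧ ∃ h : w t ≤ 1, r ⟨t, h⟩ = x := by
  set q := Nat.card (IsLocalRing.ResidueField (v.adicCompletionIntegers K)) with hq
  have h1 : w ζ ≤ 1 := spectralValuation_le_one_of_isPrimitiveRoot hn hζ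
  have hprim := isPrimitiveRoot_residue hw hr hn hζ h1
  have hm0 : q ^ n - 1 ≠ 0 := residueCard_pow_sub_one_ne_zero (v := v) hn
  have hm1 : q ^ n - 1 + 1 = q ^ n := Nat.sub_add_cancel (Nat.one_le_pow n q Nat.card_pos)
  have hx' : x ^ (q ^ n - 1 + 1) = x := by rw [hm1]; exact hx
  have hmem := mem_insert_zero_image_pow_of_pow_eq hprim hm0 hx'
  rcases Finset.mem_insert.mp hmem with rfl | hmem
  · exact ⟨0, zero_mem _, ⟨by rw [map_zero]; exact zero_le_one, by
      rw [← map_zero r]; congr 1⟩⟩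
  · obtain ⟨i, -, rfl⟩ := Finset.mem_image.mp hmem
    refine ⟨ζ ^ i, pow_mem (IntermediateField.mem_adjoin_simple_self _ ζ) i,
      ⟨by rw [map_pow]; exact pow_le_one₀ zero_le h1, ?_⟩⟩
    rw [← map_pow r]
    congr 1

include hw hrF h𝔐 hF hn hζ in
/-- Residues of integral elements of the layer lie in `𝔽_{qⁿ}`: `r(a)^{qⁿ} = r(a)` for
`a ∈ 𝒪_{K_v(ζ)}` (`Fⁿ = 1` on `K_v(ζ)` and `r(Fⁿ a) = r(a)^{qⁿ}`). [folklore] -/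
theorem residue_pow_card_pow_eq_of_mem_adjoin {a : AlgebraicClosure (v.adicCompletion K)}
    (haK : a ∈ IntermediateField.adjoin (v.adicCompletion K) {ζ}) (ha1 : w a ≤ 1) :
    r ⟨a, ha1⟩ ^ Nat.card (IsLocalRing.ResidueField (v.adicCompletionIntegers K)) ^ n = r ⟨a, ha1⟩ := by
  have hm0 := residueCard_pow_sub_one_ne_zero (v := v) hn
  have hFn : F ^ n • ζ = ζ := (frobenius_pow_smul_eq_self_iff hw h𝔐 hF hn hζ n).mpr (dvd_refl n)
  have hFa : F ^ n • a = a := (forall_smul_eq_self_iff_smul_eq hm0 hζ.pow_eq_one (F ^ n)).mpr hFn a haK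
  have h := residue_frobenius_pow_smul hw hrF n ⟨a, ha1⟩ (by rw [hFa]; exact ha1)
  rw [← h]
  congr 1
  exact Subtype.ext hFa

include hw hr hrF h𝔐 hF hn hζ in
/-- **The residue equation of the layer `K_v(ζ)`** (hypothesis `hres` of
`FormalGroupChart.exists_map_sub_eq_of_sum_eq_zero`): for `a ∈ 𝒪_{K_v(ζ)}` with
`|Σ_{j<n} Fʲ a|_v < 1` there is `b ∈ 𝒪_{K_v(ζ)}` with `|F b - b - a|_v < 1`.  On residues this is
additive Hilbert 90 for `𝔽_{qⁿ}/𝔽_q` (`exists_frobenius_sub_eq_of_trace_eq_zero`), and the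
solution is lifted by a Teichmüller representative (`exists_residue_eq_of_pow_eq`).  This is the
vanishing of `H¹(⟨F⟩, 𝔪ʳ/𝔪ʳ⁺¹)` for the unramified layer, the graded step in the classical proof of
Milne, *ADT*, Prop. I.3.8 via the filtration of the kernel of reduction (Serre, *Local Fields*,
V §2, X §1). [cite: MilneADT2006, Ch. I Prop. 3.8] -/
theorem exists_frobenius_smul_sub_sub_lt_one {a : AlgebraicClosure (v.adicCompletion K)}
    (haK : a ∈ IntermediateField.adjoin (v.adicCompletion K) {ζ}) (ha1 : w a ≤ 1)
    (htr : w (∑ j ∈ Finset.range n, F ^ j • a) < 1) :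
    ∃ b : AlgebraicClosure (v.adicCompletion K),
      b ∈ IntermediateField.adjoin (v.adicCompletion K) {ζ} ∧ w b ≤ 1 ∧ w (F • b - b - a) < 1 := by
  -- the residue field `k_v`, `q = p^f`, and the exponential characteristic of `k̄_v`
  haveI : Finite (IsLocalRing.ResidueField (v.adicCompletionIntegers K)) :=
    finite_residueField_adicCompletionIntegers K v
  letI : Fintype (IsLocalRing.ResidueField (v.adicCompletionIntegers K)) := Fintype.ofFinite _
  obtain ⟨p, hcharp, ⟨f, hpprime, hcard⟩⟩ := FiniteField.card' (IsLocalRing.ResidueField (v.adicCompletionIntegers K))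
  haveI : CharP (AlgebraicClosure (IsLocalRing.ResidueField (v.adicCompletionIntegers K))) p :=
    charP_of_injective_algebraMap (algebraMap (IsLocalRing.ResidueField (v.adicCompletionIntegers K))
      (AlgebraicClosure (IsLocalRing.ResidueField (v.adicCompletionIntegers K)))).injective p
  haveI : ExpChar (AlgebraicClosure (IsLocalRing.ResidueField (v.adicCompletionIntegers K))) p :=
    ExpChar.prime hpprime
  have hqf : Nat.card (IsLocalRing.ResidueField (v.adicCompletionIntegers K)) = p ^ (f : ℕ) := by
    rw [Nat.card_eq_fintype_card, hcard]
  have hq1 : 1 < p ^ (f : ℕ) := by rw [← hqf]; exact Finite.one_lt_card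
  -- residues
  have hm0 := residueCard_pow_sub_one_ne_zero (v := v) hn
  have h1 : w ζ ≤ 1 := spectralValuation_le_one_of_isPrimitiveRoot hn hζ
  have hprim := isPrimitiveRoot_residue hw hr hn hζ h1
  have hā : r ⟨a, ha1⟩ ^ Nat.card (IsLocalRing.ResidueField (v.adicCompletionIntegers K)) ^ n = r ⟨a, ha1⟩ :=
    residue_pow_card_pow_eq_of_mem_adjoin hw h𝔐 hF hrF hn hζ haK ha1
  -- the trace of the residue vanishes
  have hmem : ∀ j : ℕ, w (F ^ j • a) ≤ 1 := fun j ↦ spectralValuation_smul_le_one hw _ ⟨a, ha1⟩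
  have htr' : ∑ j ∈ Finset.range n,
      r ⟨a, ha1⟩ ^ Nat.card (IsLocalRing.ResidueField (v.adicCompletionIntegers K)) ^ j = 0 := by
    have hsum : (((∑ j ∈ Finset.range n, (⟨F ^ j • a, hmem j⟩ : w.integer)) : w.integer) :
        AlgebraicClosure (v.adicCompletion K)) = ∑ j ∈ Finset.range n, F ^ j • a := by
      rw [AddSubmonoidClass.coe_finsetSum]
    have h0 : r (∑ j ∈ Finset.range n, (⟨F ^ j • a, hmem j⟩ : w.integer)) = 0 := by
      rw [hr, hsum]; exact htr
    rw [map_sum] at h0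
    rw [← h0]
    refine Finset.sum_congr rfl fun j _ ↦ ?_
    rw [residue_frobenius_pow_smul hw hrF j ⟨a, ha1⟩ (hmem j)]
  -- additive Hilbert 90 on `𝔽_{qⁿ}`
  rw [hqf] at hprim hā htr'
  obtain ⟨bbar, hbfix, hb⟩ :=
    exists_frobenius_sub_eq_of_trace_eq_zero p (f : ℕ) hq1 hn hprim hā htr'
  rw [← hqf] at hbfix hb
  -- Teichmüller lift of the solution
  obtain ⟨t, htK, ht1, hrt⟩ := exists_residue_eq_of_pow_eq hw hr hn hζ hbfix
  refine ⟨t, htK, ht1, ?_⟩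
  have hFt : w (F • t) ≤ 1 := spectralValuation_smul_le_one hw F ⟨t, ht1⟩
  have e : ((⟨F • t, hFt⟩ - ⟨t, ht1⟩ - ⟨a, ha1⟩ : w.integer) : AlgebraicClosure (v.adicCompletion K)) =
      F • t - t - a := rfl
  have h0 : r (⟨F • t, hFt⟩ - ⟨t, ht1⟩ - ⟨a, ha1⟩ : w.integer) = 0 := by
    rw [map_sub, map_sub, hrF ⟨t, ht1⟩ hFt, hrt, hb, sub_self]
  rw [hr] at h0
  exact h0

end Roots

end IsDedekindDomain.HeightOneSpectrum

end
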